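import Summits.ResolutionOfSingularities.ResolutionOfSingularities.Theorems.EquisingularLiftEquisingularLiftNatTwoStepIsoHypPoint
import HarnessLib

/-!
# [OURS] ONE-STEP AND TWO-STEP ARE LOCAL ON THE BASE — THE `IFF` FORMS (locality input of the depth-graded descent)
# (cruxes `Theses.EquisingularLift.EquisingularLiftNat` / `…NatThree`, stmt-ResolutionOfSingularities-20038 / -20148)

[OURS · leafhand-res-equisingularlift-10 g1, 2026-08-31; cell `pub/decomp-res`] AI-produced, weaker than expert review; NOT a statement of any manuscript;
nothing here proves resolution of singularities in positive characteristic.  DEF-FREE helper; no `sorry`; standard axioms; ZERO named hypotheses.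

The depth-graded descent ✓ `PointChain.chain_of_finiteDepthPoints` asks its point-property `D` to be LOCAL in `iff` form: for `ρ : Γ₂ → Γ` an isomorphism
over an open `U ∋ y` and closed points `y₂ ↦ y`, `D d Γ y ↔ D d Γ₂ y₂`.  The tree has the forward transports ✓ `oneStepAt_of_isIso_morphismRestrict` (p829236),
✓ `twoStepAt_of_isIso_morphismRestrict` (p830828); here are the converses, through `Γ₂ ⊇ ρ⁻¹U ≅ U ⊆ Γ`:

* ★ `PointChain.twoStepAt_of_open` — two-step passes from an open `W ∋ y` to the ambient scheme (restrict a blow-up of `Γ` at `y` over `W`: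
  ✓ `IsBlowup.restrict`; push the finite one-step set forward along `(τ⁻¹W).ι`: closed by ✓ `isClosed_singleton_of_preimage`, one-step by ✓ `oneStepAt_of_open`);
* ★★ `PointChain.oneStepAt_iff_of_isIso_morphismRestrict`, ★★ `PointChain.twoStepAt_iff_of_isIso_morphismRestrict` — **the `iff` forms**
  (`←`: to the open `ρ⁻¹U`, across `ρ⁻¹U ≅ U` by ✓ `oneStepAt_of_iso` / ✓ `twoStepAt_of_iso`, down from the open `U`).

Honest label: closes no registered stub.

References: [GortzWedhorn2020, Prop. 13.91, (13.19)]; [StacksProject, Tags 080E, 02OS] — through the cited tree files.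
-/

set_option linter.dupNamespace false -- mandated namespace `Summit.<Summit>.<Problem>` of this single-conjunct summit

noncomputable section

open CategoryTheory CategoryTheory.Limits AlgebraicGeometry TopologicalSpace
open Literature.AlgebraicGeometry.Resolution
open AlgebraicGeometry.Scheme.IdealSheafData

namespace Summit.ResolutionOfSingularities.ResolutionOfSingularities.Cruxes.EquisingularLiftNat.Sections

namespace PointChain

universe u

/-- ★ **Two-step passes from an open to the ambient scheme**: if every blow-up of the open `W ∋ y` at its point `w₀` over the closed point `y` is regular over
`w₀` except at finitely many closed one-step points, then the same holds for every blow-up of `Γ` at `y` (restrict it over `W`: ✓ `IsBlowup.restrict`; push the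
finite set forward along the open immersion `(τ⁻¹W).ι`). [folklore] [cite: GortzWedhorn2020, Prop. 13.91] -/
theorem twoStepAt_of_open {Γ : Scheme.{u}} (W : Γ.Opens) {y : Γ} (hyW : y ∈ W) (hy : IsClosed ({y} : Set Γ))
    (w₀ : (W : Scheme.{u})) (hw₀ : W.ι w₀ = y) (hw₀cl : IsClosed ({w₀} : Set (W : Scheme.{u})))
    (htwo : ∀ (B : Scheme.{u}) (π : B ⟶ W), IsBlowup π (vanishingIdeal ⟨{w₀}, hw₀cl⟩) →
      ∃ S' : Finset B, (∀ b : B, π b = w₀ → b ∉ S' → IsRegularLocalRing (B.presheaf.stalk b)) ∧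
        ∀ b ∈ S', π b = w₀ ∧ ∃ hb : IsClosed ({b} : Set B), ∀ (B' : Scheme.{u}) (π' : B' ⟶ B),
          IsBlowup π' (vanishingIdeal ⟨{b}, hb⟩) → ∀ b' : B', π' b' = b → IsRegularLocalRing (B'.presheaf.stalk b')) :
    ∀ (Z : Scheme.{u}) (τ : Z ⟶ Γ), IsBlowup τ (vanishingIdeal ⟨{y}, hy⟩) →
      ∃ S' : Finset Z, (∀ z : Z, τ z = y → z ∉ S' → IsRegularLocalRing (Z.presheaf.stalk z)) ∧
        ∀ z ∈ S', τ z = y ∧ ∃ hz : IsClosed ({z} : Set Z), ∀ (Z' : Scheme.{u}) (τ' : Z' ⟶ Z),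
          IsBlowup τ' (vanishingIdeal ⟨{z}, hz⟩) → ∀ z' : Z', τ' z' = z → IsRegularLocalRing (Z'.presheaf.stalk z') := by
  classical
  intro Z τ hτ
  have hτW : IsBlowup (τ ∣_ W) (vanishingIdeal ⟨{w₀}, hw₀cl⟩) := by
    have h := hτ.restrict W
    rwa [comap_vanishingIdeal_singleton_openι W hy w₀ hw₀ hw₀cl] at h
  obtain ⟨SW, hregW, hSW⟩ := htwo _ (τ ∣_ W) hτW
  let S' : Finset Z := SW.image (τ ⁻¹ᵁ W).ι
  -- a point `z` over `y` and its avatar in `τ⁻¹ W`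
  have havatar : ∀ z : Z, τ z = y → ∃ zW : (τ ⁻¹ᵁ W : Scheme.{u}), (τ ⁻¹ᵁ W).ι zW = z ∧ (τ ∣_ W) zW = w₀ := by
    intro z hz
    have hzW : z ∈ τ ⁻¹ᵁ W := by change τ z ∈ W; rw [hz]; exact hyW
    refine ⟨⟨z, hzW⟩, rfl, ?_⟩
    apply W.ι.isOpenEmbedding.injective
    rw [hw₀, ← Scheme.Hom.comp_apply, morphismRestrict_ι, Scheme.Hom.comp_apply]
    exact hz
  refine ⟨S', fun z hz hzS => ?_, fun z hz => ?_⟩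
  · -- regular off `S'`
    obtain ⟨zW, hzW', hτzW⟩ := havatar z hz
    have hzWS : zW ∉ SW := fun h => hzS (Finset.mem_image.mpr ⟨zW, h, hzW'⟩)
    haveI := hregW zW hτzW hzWS
    rw [← hzW']
    exact IsRegularLocalRing.of_ringEquiv (R := (τ ⁻¹ᵁ W : Scheme.{u}).presheaf.stalk zW)
      (asIso (((τ ⁻¹ᵁ W).ι).stalkMap zW)).commRingCatIsoToRingEquiv.symm
  · -- the points of `S'`: over `y`, closed, one-step
    obtain ⟨zW, hzWS, rfl⟩ := Finset.mem_image.mp hz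
    obtain ⟨hτzW, hzWcl, honez⟩ := hSW zW hzWS
    have hτz : τ ((τ ⁻¹ᵁ W).ι zW) = y := by
      rw [← Scheme.Hom.comp_apply, ← morphismRestrict_ι, Scheme.Hom.comp_apply, hτzW, hw₀]
    have hzcl : IsClosed ({(τ ⁻¹ᵁ W).ι zW} : Set Z) :=
      isClosed_singleton_of_preimage τ W (by rw [hτz]; exact hy) (by rw [hτz]; exact hyW) zW rfl hzWcl
    exact ⟨hτz, hzcl, oneStepAt_of_open (τ ⁻¹ᵁ W) (show τ ((τ ⁻¹ᵁ W).ι zW) ∈ W by rw [hτz]; exact hyW) hzcl zW rfl hzWcl honez⟩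

/-- ★★ **ONE-STEP IS LOCAL ON THE BASE, `iff` form.**  `ρ : Γ₂ → Γ` an isomorphism over an open `U ∋ y`, `y` and `y₂ ↦ y` closed: every blow-up of `Γ` at
`y` is regular over `y` iff every blow-up of `Γ₂` at `y₂` is regular over `y₂` (`→` ✓ `oneStepAt_of_isIso_morphismRestrict`; `←` through
`Γ₂ ⊇ ρ⁻¹U ≅ U ⊆ Γ`: ✓ `oneStepAt_to_open`, ✓ `oneStepAt_of_iso`, ✓ `oneStepAt_of_open`). [folklore] [cite: GortzWedhorn2020, (13.19)] -/
theorem oneStepAt_iff_of_isIso_morphismRestrict {Γ Γ₂ : Scheme.{u}} (ρ : Γ₂ ⟶ Γ) (U : Γ.Opens) [IsIso (ρ ∣_ U)]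
    {y : Γ} (hyU : y ∈ U) (hy : IsClosed ({y} : Set Γ)) {y₂ : Γ₂} (hy₂ : ρ y₂ = y) (hy₂cl : IsClosed ({y₂} : Set Γ₂)) :
    (∀ (B : Scheme.{u}) (π : B ⟶ Γ), IsBlowup π (vanishingIdeal ⟨{y}, hy⟩) →
      ∀ b : B, π b = y → IsRegularLocalRing (B.presheaf.stalk b)) ↔
    (∀ (Z : Scheme.{u}) (τ : Z ⟶ Γ₂), IsBlowup τ (vanishingIdeal ⟨{y₂}, hy₂cl⟩) →
      ∀ z : Z, τ z = y₂ → IsRegularLocalRing (Z.presheaf.stalk z)) := by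
  refine ⟨fun hone => oneStepAt_of_isIso_morphismRestrict ρ U hyU hy hone hy₂ hy₂cl, fun hone₂ => ?_⟩
  -- the open `V = ρ⁻¹ U ∋ y₂` and the isomorphism `e : V ≅ U`
  set V : Γ₂.Opens := ρ ⁻¹ᵁ U with hV
  have hy₂V : y₂ ∈ V := by change ρ y₂ ∈ U; rw [hy₂]; exact hyU
  let e : (V : Scheme.{u}) ≅ (U : Scheme.{u}) := asIso (ρ ∣_ U)
  obtain ⟨u₀, hu₀⟩ : ∃ u₀ : (U : Scheme.{u}), U.ι u₀ = y := ⟨⟨y, hyU⟩, rfl⟩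
  obtain ⟨v₀, hv₀⟩ : ∃ v₀ : (V : Scheme.{u}), V.ι v₀ = y₂ := ⟨⟨y₂, hy₂V⟩, rfl⟩
  have hev : e.hom v₀ = u₀ := by
    apply U.ι.isOpenEmbedding.injective
    rw [hu₀, ← Scheme.Hom.comp_apply]
    change ((ρ ∣_ U) ≫ U.ι) v₀ = y; rw [morphismRestrict_ι, Scheme.Hom.comp_apply, hv₀, hy₂]
  subst hev
  have hu₀cl := isClosed_singleton_of_openι_eq U hy (e.hom v₀) hu₀
  have hv₀cl := isClosed_singleton_of_openι_eq V hy₂cl v₀ hv₀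
  -- `y₂` ⟹ `v₀` (to the open `V`) ⟹ `e v₀` (across `e`) ⟹ `y` (down from the open `U`)
  have h1 := oneStepAt_to_open V hy₂V hy₂cl hone₂ v₀ hv₀ hv₀cl
  have h2 := oneStepAt_of_iso e hv₀cl h1 hu₀cl
  exact oneStepAt_of_open U hyU hy (e.hom v₀) hu₀ hu₀cl h2

/-- ★★ **TWO-STEP IS LOCAL ON THE BASE, `iff` form.**  `ρ : Γ₂ → Γ` an isomorphism over an open `U ∋ y`, `y` and `y₂ ↦ y` closed: `y` is two-step on `Γ`
iff `y₂` is two-step on `Γ₂` (`→` ✓ `twoStepAt_of_isIso_morphismRestrict`; `←` through `Γ₂ ⊇ ρ⁻¹U ≅ U ⊆ Γ`: the forward transport along `(ρ⁻¹U).ι`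
(✓ `isIso_ι_morphismRestrict_self`), ✓ `twoStepAt_of_iso`, `twoStepAt_of_open`). [OURS] [cite: GortzWedhorn2020, Prop. 13.91, (13.19)] -/
theorem twoStepAt_iff_of_isIso_morphismRestrict {Γ Γ₂ : Scheme.{u}} (ρ : Γ₂ ⟶ Γ) (U : Γ.Opens) [IsIso (ρ ∣_ U)]
    {y : Γ} (hyU : y ∈ U) (hy : IsClosed ({y} : Set Γ)) {y₂ : Γ₂} (hy₂ : ρ y₂ = y) (hy₂cl : IsClosed ({y₂} : Set Γ₂)) :
    (∀ (B : Scheme.{u}) (π : B ⟶ Γ), IsBlowup π (vanishingIdeal ⟨{y}, hy⟩) →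
      ∃ S' : Finset B, (∀ b : B, π b = y → b ∉ S' → IsRegularLocalRing (B.presheaf.stalk b)) ∧
        ∀ b ∈ S', π b = y ∧ ∃ hb : IsClosed ({b} : Set B), ∀ (B' : Scheme.{u}) (π' : B' ⟶ B),
          IsBlowup π' (vanishingIdeal ⟨{b}, hb⟩) → ∀ b' : B', π' b' = b → IsRegularLocalRing (B'.presheaf.stalk b')) ↔
    (∀ (Z : Scheme.{u}) (τ : Z ⟶ Γ₂), IsBlowup τ (vanishingIdeal ⟨{y₂}, hy₂cl⟩) →
      ∃ S' : Finset Z, (∀ z : Z, τ z = y₂ → z ∉ S' → IsRegularLocalRing (Z.presheaf.stalk z)) ∧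
        ∀ z ∈ S', τ z = y₂ ∧ ∃ hz : IsClosed ({z} : Set Z), ∀ (Z' : Scheme.{u}) (τ' : Z' ⟶ Z),
          IsBlowup τ' (vanishingIdeal ⟨{z}, hz⟩) → ∀ z' : Z', τ' z' = z → IsRegularLocalRing (Z'.presheaf.stalk z')) := by
  refine ⟨fun htwo => twoStepAt_of_isIso_morphismRestrict ρ U hyU hy htwo hy₂ hy₂cl, fun htwo₂ => ?_⟩
  -- the open `V = ρ⁻¹ U ∋ y₂` and the isomorphism `e : V ≅ U`
  set V : Γ₂.Opens := ρ ⁻¹ᵁ U with hV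
  have hy₂V : y₂ ∈ V := by change ρ y₂ ∈ U; rw [hy₂]; exact hyU
  let e : (V : Scheme.{u}) ≅ (U : Scheme.{u}) := asIso (ρ ∣_ U)
  obtain ⟨u₀, hu₀⟩ : ∃ u₀ : (U : Scheme.{u}), U.ι u₀ = y := ⟨⟨y, hyU⟩, rfl⟩
  obtain ⟨v₀, hv₀⟩ : ∃ v₀ : (V : Scheme.{u}), V.ι v₀ = y₂ := ⟨⟨y₂, hy₂V⟩, rfl⟩
  have hev : e.hom v₀ = u₀ := by
    apply U.ι.isOpenEmbedding.injective
    rw [hu₀, ← Scheme.Hom.comp_apply]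
    change ((ρ ∣_ U) ≫ U.ι) v₀ = y; rw [morphismRestrict_ι, Scheme.Hom.comp_apply, hv₀, hy₂]
  subst hev
  have hu₀cl := isClosed_singleton_of_openι_eq U hy (e.hom v₀) hu₀
  have hv₀cl := isClosed_singleton_of_openι_eq V hy₂cl v₀ hv₀
  -- `y₂` ⟹ `v₀` (to the open `V`) ⟹ `e v₀` (across `e`) ⟹ `y` (down from the open `U`)
  haveI := isIso_ι_morphismRestrict_self V
  have h1 := twoStepAt_of_isIso_morphismRestrict V.ι V hy₂V hy₂cl htwo₂ hv₀ hv₀cl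
  have h2 := twoStepAt_of_iso e hv₀cl h1 hu₀cl
  exact twoStepAt_of_open U hyU hy (e.hom v₀) hu₀ hu₀cl h2

end PointChain

end Summit.ResolutionOfSingularities.ResolutionOfSingularities.Cruxes.EquisingularLiftNat.Sections

end
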